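import Summits.ResolutionOfSingularities.ResolutionOfSingularities.Theorems.EquisingularLiftEquisingularLiftNatF102PullbackIdealSection
import Summits.ResolutionOfSingularities.ResolutionOfSingularities.Theorems.EquisingularLiftEquisingularLiftNatF102PullbackSheafHom
import Summits.ResolutionOfSingularities.ResolutionOfSingularities.Theorems.EquisingularLiftEquisingularLiftNatF102IdealModulePtHomIso
import Summits.ResolutionOfSingularities.ResolutionOfSingularities.Theorems.EquisingularLiftEquisingularLiftNatP1VBHomTransfer
import Literature.AlgebraicGeometry.Modules.SheafHomFunctor
import Literature.AlgebraicGeometry.Deformation.IdealModulePushforward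
import HarnessLib

/-!
# [OURS · L1 W4.5(b) · LINE (T-j)-PROOF · BRICK B4 (γ*)] The special-fibre triviality
# `i^*𝓗om(𝓘_{D₀}, 𝓘_{D₁}) ≅ 𝒪_{C_k}`

Cell res-hironaka, LADDER-RESOLUTION rung L, slot W4.5(b), crux chain w45b: EL♮(3) = stmt-ResolutionOfSingularities-20148, residue
(T-j) = F-102 `Literature.AlgebraicGeometry.Resolution.GenusZeroOverCompleteDVR` (LINE (T-j)-PROOF, res-L1-w45b-lead-2 g3, skeleton v3
1683bb741349c142), BRICK B4 = `F102.exists_coordinate_functions_of_trivial_pullback` (res-L1-type-o6, p581462) MODULO its hypothesis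
`hN` — THIS FILE discharges `hN`. `--supports stmt-ResolutionOfSingularities-20148 --as helper`. NOT a statement of any manuscript; OURS;
AI-written, weaker than expert review. No `sorry`; standard axioms; DEF-FREE. (Assembly of the (γ*) skeleton `GammaStarSkeleton`
7d8d5eef49743d69 on the landed bricks.)

THEOREM (`nonempty_pullback_sheafHom_idealModule_iso_unit`). `O` a DVR, `θ : O ↠ k`, `f : C → Spec O` proper flat, `C` regular integral,
`(i, t)` cartesian over `Spec θ`, `e : C_k ≅ ℙ¹_{k'}`, sections `s₀ ∋ i(e⁻¹(1:0))`, `s₁ ∋ i(e⁻¹(0:1))`. Then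
`i^*𝓗om(𝓘_{D₀}, 𝓘_{D₁}) ≅ 𝒪_{C_k}`.

PROOF. (β) `i^*𝓗om(𝓘₀, 𝓘₁) ≅ 𝓗om(i^*𝓘₀, i^*𝓘₁)` (res-D-pv-036 `nonempty_pullback_sheafHom_iso_of_isVectorBundle`, p581953; the `𝓘_j` are
line bundles by res-L1-type-o6's (a3) `isVectorBundle_idealModule_of_section`); (α) `i^*𝓘_j ≅ 𝓘_{pt_j ≫ e⁻¹}` (lead-2, …NatF102PullbackIdealSection);
(γ) `𝓘_{(1:0)} ≅ 𝓘_{(0:1)}` on `ℙ¹_{k'}` (res-rescue-typ-5 `nonempty_idealModule_ptHom_iso`, p581858), pushed forward along `e⁻¹`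
(`idealModulePushforwardIso`); hence `i^*𝓘₁ ≅ i^*𝓘₀` and `𝓗om(i^*𝓘₀, i^*𝓘₁) ≅ 𝓗om(L, L) ≅ 𝒪` for the line bundle `L = i^*𝓘₀`
(`P1VB.isIso_sheafHomUnit_of_lineBundle`, frames of `L` = `pullbackFrame` of the rank-one frames of `𝓘₀`).
-/

noncomputable section

open CategoryTheory CategoryTheory.Limits AlgebraicGeometry TopologicalSpace Opposite IsLocalRing
open Literature.AlgebraicGeometry Literature.AlgebraicGeometry.Morphisms Literature.AlgebraicGeometry.Modules
open Literature.AlgebraicGeometry.Motives Literature.AlgebraicGeometry.Deformation Literature.AlgebraicGeometry.HodgeTheory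

set_option linter.dupNamespace false -- mandated namespace `Summit.<Summit>.<Problem>` of this single-conjunct summit

namespace Summit.ResolutionOfSingularities.ResolutionOfSingularities.Cruxes.EquisingularLiftNat.F102

/-- The ideal `𝓘_D` of a section `D = s(Spec O)` is free of rank one near every point of `C` (res-L1-type-o6's
`exists_affine_principal` + (a1) `nonempty_free_iso_over_idealModule_of_span_singleton`, reindexed `PUnit ≃ Fin 1`). [OURS · glue] -/
theorem exists_frame_idealModule_section (O : Type) [CommRing O] [IsDomain O]
    [IsDiscreteValuationRing O] (k : Type) [Field k] (θ : O →+* k)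
    (C : Scheme.{0}) (f : C ⟶ Spec (.of O)) [IsProper f] [Flat f]
    (Ck : Scheme.{0}) (i : Ck ⟶ C) (t : Ck ⟶ Spec (.of k)) [IsIntegral C]
    (hθ : Function.Surjective θ) (hreg : Resolution.Scheme.IsRegular C)
    (hsq : IsPullback i t f (Spec.map (CommRingCat.ofHom θ)))
    (hP1 : ∃ (k' : Type) (_ : Field k'), Nonempty (Ck ≅ ProjCech.PP k' 1))
    (s : Spec (.of O) ⟶ C) (hs : s ≫ f = 𝟙 _) (x : C) :
    ∃ (W : C.Opens) (_ : x ∈ W), Nonempty (SheafOfModules.free (Fin 1) ≅ (idealModule s).over W) := by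
  have hri := isRegularImmersionOfCodim_one_of_section O k θ C f Ck i t hθ hreg hsq hP1 s hs
  haveI : IsClosedImmersion s := hri.1
  haveI : IsLocallyNoetherian C := LocallyOfFiniteType.isLocallyNoetherian f
  obtain ⟨V, hxV, r, hr, hI⟩ := exists_affine_principal s hri x
  haveI : Nonempty (V : C.Opens) := ⟨⟨x, hxV⟩⟩
  haveI : IsDomain Γ(C, (V : C.Opens)) := inferInstance
  have hx' : ∀ a : Γ(C, (V : C.Opens)), a * r = 0 → a = 0 := fun a ha =>
    (mul_eq_zero.mp ha).resolve_right hr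
  obtain ⟨ε⟩ := nonempty_free_iso_over_idealModule_of_span_singleton (i := s) V r hx' hI.symm
  exact ⟨V, hxV, ⟨SheafOfModules.freeFunctor.mapIso (Equiv.equivPUnit.{1, 1} (Fin 1)).toIso ≪≫ ε⟩⟩

/-- **(γ*) — special-fibre triviality of `𝓗om(𝓘_{D₀}, 𝓘_{D₁})`**: `i^*𝓗om(𝓘_{D₀}, 𝓘_{D₁}) ≅ 𝒪_{C_k}` — the hypothesis `hN` of
res-L1-type-o6's BRICK B4 `exists_coordinate_functions_of_trivial_pullback`. Assembly of (β) (res-D-pv-036), (α) (lead-2), (γ)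
(res-rescue-typ-5) and `𝓗om(L, L) ≅ 𝒪`. [OURS] -/
theorem nonempty_pullback_sheafHom_idealModule_iso_unit (O : Type) [CommRing O] [IsDomain O]
    [IsDiscreteValuationRing O] (k : Type) [Field k] (θ : O →+* k)
    (C : Scheme.{0}) (f : C ⟶ Spec (.of O)) [IsProper f] [Flat f]
    (Ck : Scheme.{0}) (i : Ck ⟶ C) (t : Ck ⟶ Spec (.of k)) [IsIntegral C]
    (hθ : Function.Surjective θ) (hreg : Resolution.Scheme.IsRegular C)
    (hsq : IsPullback i t f (Spec.map (CommRingCat.ofHom θ)))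
    (k' : Type) [Field k'] (e : Ck ≅ ProjCech.PP k' 1)
    (s₀ s₁ : Spec (.of O) ⟶ C) (hs₀ : s₀ ≫ f = 𝟙 _) (hs₁ : s₁ ≫ f = 𝟙 _)
    (hz₀ : s₀.base (closedPoint O) = i.base (e.inv.base (ProjLine.y k' 0)))
    (hz₁ : s₁.base (closedPoint O) = i.base (e.inv.base (ProjLine.y k' 1))) :
    Nonempty ((Scheme.Modules.pullback i).obj (sheafHom (idealModule s₀) (idealModule s₁)) ≅ unitModule Ck) := by
  have hP1 : ∃ (k' : Type) (_ : Field k'), Nonempty (Ck ≅ ProjCech.PP k' 1) := ⟨k', inferInstance, ⟨e⟩⟩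
  have hI₀ := isVectorBundle_idealModule_of_section O k θ C f Ck i t hθ hreg hsq hP1 s₀ hs₀
  have hI₁ := isVectorBundle_idealModule_of_section O k θ C f Ck i t hθ hreg hsq hP1 s₁ hs₁
  -- (β)
  obtain ⟨e₁⟩ := nonempty_pullback_sheafHom_iso_of_isVectorBundle i hI₀ hI₁
  -- (α) twice and (γ) pushed forward along `e⁻¹`
  obtain ⟨a₀⟩ := nonempty_pullback_idealModule_section_iso O k θ C f Ck i t hθ hreg hsq k' e s₀ hs₀ 0 hz₀
  obtain ⟨a₁⟩ := nonempty_pullback_idealModule_section_iso O k θ C f Ck i t hθ hreg hsq k' e s₁ hs₁ 1 hz₁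
  obtain ⟨γ⟩ := nonempty_idealModule_ptHom_iso k'
  let T₀ : idealModule (ProjLine.ptHom k' 0 ≫ e.inv) ≅
      (Scheme.Modules.pushforward e.inv).obj (idealModule (ProjLine.ptHom k' 0)) :=
    idealModulePushforwardIso (ProjLine.ptHom k' 0) e.symm
  let T₁ : idealModule (ProjLine.ptHom k' 1 ≫ e.inv) ≅
      (Scheme.Modules.pushforward e.inv).obj (idealModule (ProjLine.ptHom k' 1)) :=
    idealModulePushforwardIso (ProjLine.ptHom k' 1) e.symm
  let ε : (Scheme.Modules.pullback i).obj (idealModule s₁) ≅ (Scheme.Modules.pullback i).obj (idealModule s₀) :=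
    a₁ ≪≫ T₁ ≪≫ ((Scheme.Modules.pushforward e.inv).mapIso γ).symm ≪≫ T₀.symm ≪≫ a₀.symm
  -- `𝓗om(L, L) ≅ 𝒪` for the line bundle `L = i^*𝓘_{D₀}`
  have hL₀ := exists_frame_idealModule_section O k θ C f Ck i t hθ hreg hsq hP1 s₀ hs₀
  have hL : ∀ y : Ck, ∃ (W : Ck.Opens) (_ : y ∈ W), Nonempty (SheafOfModules.free (Fin 1) ≅
      ((Scheme.Modules.pullback i).obj (idealModule s₀)).over W) := fun y => by
    obtain ⟨W, hW, ⟨φ⟩⟩ := hL₀ (i.base y)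
    exact ⟨i ⁻¹ᵁ W, hW, ⟨pullbackFrame i φ⟩⟩
  haveI := P1VB.isIso_sheafHomUnit_of_lineBundle _ hL
  exact ⟨e₁ ≪≫ (sheafHomFunctor ((Scheme.Modules.pullback i).obj (idealModule s₀))).mapIso ε ≪≫
    (asIso (sheafHomUnit ((Scheme.Modules.pullback i).obj (idealModule s₀)))).symm⟩

end Summit.ResolutionOfSingularities.ResolutionOfSingularities.Cruxes.EquisingularLiftNat.F102

end
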